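import Summits.QuantumFields.YangMills.Theorems.UnitScaleTiltProp7SectET3N06LeavesRecordH
import Summits.QuantumFields.YangMills.Theorems.UnitScaleTiltProp7SectET3GeometryFam
import HarnessLib

/-!
# Route `UnitScaleTilt` (α), node N06(d = 3) — **THE H-SIDE T³ LEAF OF RECORD (THEOREM 3.12 AS THE WHOLE PRINTED LEAF) ALONG AN ARBITRARY SUB-FAMILY `π : J → KIdx 2 ℓ hd3 hL b₀ b₁`**:
# ★w1-20520's `Prop7SectET3N06LeavesRecordH.t312_of_pins_T3_completePairMBZ` with every displayed row read over `x : J` at `geo9K (π x)` ∕ `bgT3 (π x)` and the conclusion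
# `B9.Thm312Printed 3 c35 (geo9K ∘ π) (bgT3 ∘ π) …` — the H half of the «record re-cut over `{i // 1 ≤ i.m}`» (the `norm_H₁` ∕ `norm_H` knits read the record there too)

Cell `ym-inputs` (D-0154 (2); desk `ym-inputs-plan-1` INPUT-LIST §4 row p05; HANDOFF §§ ym-inputs-p05 g2∕g3∕g4 item (2); memo `pub/ym-inputs/L0F-DEF-DESIGN-p05g2.md` §2 (A)),
seat ym-inputs-p05 g5.  Count-neutral helper (`--supports stmt-QuantumFields-20520 --as helper`); registry untouched; THEOREMS ONLY (0 `def`, 0 `sorry`); NOTHING of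
[Balaban1985BackgroundPropagators] is asserted.

WHY.  As for the G side (`Prop7SectET3N06LeavesRecordCutFam`): the record `Prop7SectET3OpsT3.opsT3` is genuine exactly on `1 ≤ i.m`; the H-side knit of record
(`…N06LeavesRecordHStepLayerEvalRowsS.normH₁_row_of_letterLayers_evaluationRowsS`) displays `∀ i : KIdx 2 ℓ hd3 hL 1 1`-rows unprovable at the junk indices, and reads this leaf.
Track A's `thm312Printed_completePairMBZ` is index-generic; only the T³ port fixed `KIdx`.
WHAT.  ★★★ `t312_of_pins_completePairMBZ_fam π` — the statement of `t312_of_pins_T3_completePairMBZ` with EXACTLY these changes: every binder `i : KIdx 2 ℓ hd3 hL b₀ b₁` becomes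
`i : J`, every `geo9K i` ∕ `bgT3 i` ∕ `RelB i` ∕ `geoOK_geo9K i` becomes `geo9K (π i)` ∕ `bgT3 (π i)` ∕ `RelB (π i)` ∕ `geoOK_geo9K (π i)` (carriers `J → Type`, `H₀ : J → Prop`), and the
conclusion is `B9.Thm312Printed (2 + 1) c35 (fun i ↦ geo9K (π i)) (fun i ↦ bgT3 (π i)) GD G₁ Hk H₁k HasRWExp HasRWExpH PosDefK`; instance binders stay the whole family's.  PROOF:
★w1's floor argument VERBATIM over `{i : J // M⋆ ≤ (geo9K (π i)).M}` — `thm312Printed_of_floor` (index-generic), `Prop7SectET3GeometryFam.hnbr_geo9K_floor_fam ∕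
lemma21AboveG_geo9K_fam ∕ hCL_geo9K_floor_fam`, the whole family's `rowSum261_geo9K` read at `π j`, the pointwise geometry facts at `π j`.  The original is the `π := id` reading
(untouched, additive); the record instantiation uses `π := (·.1)` on `{i : KIdx 2 ℓ hd3 hL 1 1 // 1 ≤ i.m}`.
L-FLOOR: none beyond the parent's.  HONEST SCOPE: a re-indexing of a by-name port; every analytic row stays a displayed HYPOTHESIS about the genuine operators; N06(d = 3) NOT
discharged; nothing here claims EX, the crux, V3∕R3, d = 4 or the mass gap; YM₃ on T³ = ladder rung R3 (RECORD), not the Clay problem.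

References: T. Bałaban, CMP **99** (1985) 389–434 [Balaban1985BackgroundPropagators] (Thm 3.12 p.423, (3.133) p.422, (3.39)–(3.47) pp.397–398); CMP **96** (1984) 223–250
[Balaban1984PropagatorsII] (Lemma 2.1 (2.59)–(2.61) pp.233–234).
-/

set_option autoImplicit false

noncomputable section

open scoped Matrix.Norms.L2Operator

namespace Summit.QuantumFields.YangMills.Theorems.Prop7SectET3N06LeavesRecordHFam


open Literature.MathematicalPhysics.QuantumFieldTheory.Balaban1983to89
open Finset B6RandomWalk B6RandomWalkHom B9Thm34Ext B9Thm37Glue B9Thm37GlueCor36 B11SectG B9SectDSup B9SectDL2Decay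
open B9Thm37AllNorms B9Thm37AllNormsInstances B9FromB6 B9FromB6ModelSignsOn B9SectBStepWhole B9Thm312Whole B9Thm312WholeLeaf
open B9Thm312WholeLeft B9Thm312WholeH B9Thm312WholeLeafLeftGlob B9Ineq347CoReading B9SectCDiffDict B9CoRealizesRel B9CoRealizesHRel
open B9RWSums343Holder B9RWSumsReadsRel B9RWSumsReadsNbr B9Ineq347 B9Thm312WholeClasses B9Thm312WholeHolder B9Thm312WholeL2
open B9Thm312WholeBlocksRel B9Thm312WholeBlocksNbr B9Thm312WholeLeafAll B9Thm312WholeHHolder B9Thm312WholeHHolderNbr B9Thm312WholeLeafRelH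
open B9RWSums346SecondDiff B9Thm312WholeLeafCompleteNbr B9Thm312WholeBlocksNbrRec B9RWSums344InputFam B9Thm312WholeDir
open B9Thm312WholeBlocksPairM B9Thm312WholeLeafCompletePairM B9Thm312WholeDirB B9Thm312WholeBlocksPairMB B9Thm312WholeHZ B9Thm312WholeLeafRelHZ
open B9Thm312WholeLeafCompletePairMBZ (thm312Printed_completePairMBZ)
open B6KLevelCensusIndexV1 (KIdx)
open B9GeoNormsKLevelV1 (geo9K)
open B9CoRealizesRelAtLetters (RelB maj342_relB_left maj342_relB_right dist_eq_of_relB relB_refl len_eq_of_relB)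
open B9GeoLemma21KLevelV1 (rowSum261_geo9K geo9K_one_le_L geo9K_eta_pos)
open B9GeoNormsKLevelModelSignsV1 (modelSignsOn_geo9K)
open Summit.QuantumFields.YangMills.Theorems.Prop7SectET3Members (hd3)
open Summit.QuantumFields.YangMills.Theorems.Prop7SectET3Geometry (geoOK_geo9K geo9K_L_le)
open Summit.QuantumFields.YangMills.Theorems.Prop7SectET3BgClass (bgT3)
open Summit.QuantumFields.YangMills.Theorems.Prop7SectET3N06LeavesRelZ (card_filter_relB_le)
open Summit.QuantumFields.YangMills.Theorems.Prop7SectET3Floor (thm312Printed_of_floor)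
open Summit.QuantumFields.YangMills.Theorems.Prop7SectET3GeometryFam (lemma21AboveG_geo9K_fam hnbr_geo9K_floor_fam hCL_geo9K_floor_fam)


variable {ℓ : ℕ} {hL : Odd (ℓ + 1) ∧ 1 < ℓ + 1} {b₀ b₁ : ℝ} {c35 : ℝ} {J : Type} (π : J → KIdx 2 ℓ hd3 hL b₀ b₁)

/-- (**SUB-FAMILY READING along `π : J → KIdx 2 ℓ hd3 hL b₀ b₁`**: `i : J`, `geo9K (π i)`, `bgT3 (π i)`, `RelB (π i)` throughout; otherwise VERBATIM:) ★★★ **THEOREM 3.12 AS THE WHOLE PRINTED LEAF — THE SPECIES OF RECORD (`thm312Printed_completePairMBZ`: residual ABSORBED, Z-classed H-letters, carrier-relative co-readings) — READ AT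
THE T³ INDEX** (d + 1 = 3): at `I := KIdx 2 ℓ hd3 hL b₀ b₁`, `geo := geo9K`, `bg := bgT3`, `R₀ ≡ 1`, relation `RelB` (multiplicity `m = 6`), `C_L = Lc = ℓ + 1`.  DISPLAYED VERBATIM over the full T³
index: letter records `𝔬`, probes `𝔭`, input norms `bHX`, direction letters `Dd ∕ Dds`, the two kernel families `GD`, `G₁` and the two H-kernels `Hk`, `H₁k` with their co-readings
(`hcoR hco1R hcoHR hcoG hl2N hH1N hIF hHCN`), the symmetry `hsym`, `hmodel` (Thm 3.3 for `G₀` = XL, Steps, FormSmall, Identities), `hleft`, the coarse block norm `bZ` (`κ = 1`) with the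
Z-classed H-letters `hlettersH` (`LettersHZ`) and `hLHH` (`LettersHHZ`), the direction-indexed rows `hG0C`, the steps `hstepC` (`StepDirB ∧ StepL2`), the numerics with their signs ∕ rate
relations.  DISCHARGED HERE: geometry rows, the row sum (2.61) at `σ > 0`, `Lemma21AboveG` at `α ∈ (0, ½]`, `hnbr`∕`hCL` ABOVE A FLOOR (`Prop7SectET3Floor`, `M⋆ := max M_nbr (r+1)`, lift
`thm312Printed_of_floor`), `RelB`'s saturation ∕ multiplicity ∕ distance ∕ length rows.  Conclusion: `B9.Thm312Printed (2 + 1) c35 geo9K bgT3 GD G₁ Hk H₁k HasRWExp HasRWExpH PosDefK` —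
the leaf whose global H₁-member OWNER RULING g25-№2 reads as `SectEDatum.norm_H₁`'s N06 input.  Nothing of print asserted; NOT a discharge of N06(d = 3).
[cite: Balaban1985BackgroundPropagators, Thm 3.12 (3.130)-(3.138) pp.421-423, (3.126) p.420, (3.132)-(3.133) p.422, (3.42)-(3.47) pp.397-398; Balaban1984PropagatorsII, (2.3) p.224, (2.45)-(2.46) p.231, Lemma 2.1 (2.59)-(2.61) pp.233-234] -/
theorem t312_of_pins_completePairMBZ_fam [∀ i : KIdx 2 ℓ hd3 hL b₀ b₁, Fintype (geo9K i).Site] [∀ i : KIdx 2 ℓ hd3 hL b₀ b₁, DecidableEq (geo9K i).Site]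
    {X Y Z W PX PY : J → Type} {P : Type} [∀ i, Fintype (X i)] [∀ i, DecidableEq (X i)] [∀ i, Fintype (Y i)]
    [∀ i, Fintype (Z i)] [∀ i, Fintype (W i)] [∀ i, Fintype (PX i)] [∀ i, Fintype (PY i)] [Fintype P]
    (𝔬 : ∀ i : J, Ops (geo9K (π i)) (bgT3 (π i)) (X i) (Y i) (Z i) (W i)) (H₀ : J → Prop)
    (𝔭 : ∀ i : J, HolderProbes (geo9K (π i)) (bgT3 (π i)) (X i) (Y i) (PX i) (PY i))
    (bHX : ∀ i : J, ℝ → BlockNorm (toB6 (geo9K (π i)) 1 (H₀ i)) (X i → ℝ))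
    (Dd Dds : ∀ i : J, (bgT3 (π i)).Cfg → P → Module.End ℝ (X i → ℝ))
    (GD G₁ : ∀ i : J, B9.KernelFamily (geo9K (π i)) (bgT3 (π i))) (Hk H₁k : ∀ i : J, B9.HKernel (geo9K (π i)) (bgT3 (π i)))
    (ev : ∀ i : J, (geo9K (π i)).Loc → X i → ℝ) (evY : ∀ i : J, (geo9K (π i)).Loc → Y i → ℝ)
    (r Cev θ₁ θD θ₂ r₁ B₀ B₂ δ₀ δK σ ρ ρf a₁ M₁ B₃ δ₃ α : ℝ) (Bh Bi Bq θH θI : ℝ → ℝ) (Bi2 : ℝ → ℝ → ℝ)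
    (hθ₁ : 0 ≤ θ₁) (hθD : 0 ≤ θD) (hθH : ∀ β, 0 ≤ β → β < 1 → 0 ≤ θH β) (hθI : ∀ ε, 0 < ε → 0 ≤ θI ε) (hθ₂ : 0 ≤ θ₂) (hr₁ : 0 ≤ r₁) (hB₀ : 0 ≤ B₀) (hB₂ : 0 ≤ B₂) (hB₃ : 0 ≤ B₃)
    (hσ : 0 < σ) (hρ : 0 < ρ) (hρS : ρ ≤ δ₀) (hρδ : ρ + σ ≤ δK) (hρ₃ : ρ + σ ≤ δ₃) (ha₁ : 0 < a₁) (hM₁ : 0 < M₁)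
    (hα : α ≤ 1 / 2) (hα0 : 0 < α) (hρf : 0 < ρf) (hρf1 : ρf + σ ≤ (1 - α) * ρ) (hρf2 : ρf + 2 * σ + α * ρ ≤ ρ)
    (hBh : ∀ β, 0 ≤ β → β < 1 → 0 ≤ Bh β) (hBi : ∀ ε, 0 < ε → ε ≤ 1 → 0 ≤ Bi ε)
    (hBi2 : ∀ ε β, 0 < ε → ε ≤ 1 → 0 ≤ β → β < 1 → 0 ≤ Bi2 ε β) (hBq : ∀ β, 0 ≤ Bq β)
    (hCev : 0 ≤ Cev)
    (hcoR : ∀ (i : J) (U : (bgT3 (π i)).Cfg),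
      CoRealizesRel (GD i) 0 U (RelB (π i)) (𝔬 i).blk (𝔬 i).blk (ev i) ((𝔬 i).G U) ∧
      CoRealizesRel (GD i) 2 U (RelB (π i)) (𝔬 i).blk (𝔬 i).blkY (evY i) ((𝔬 i).G U ∘ₗ (𝔬 i).Dstar U) ∧
      CoRealizesRel (G₁ i) 0 U (RelB (π i)) (𝔬 i).blk (𝔬 i).blk (ev i) ((𝔬 i).G1 U) ∧
      CoRealizesRel (G₁ i) 2 U (RelB (π i)) (𝔬 i).blk (𝔬 i).blkY (evY i) ((𝔬 i).G1 U ∘ₗ (𝔬 i).Dstar U))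
    (hco1R : ∀ (i : J) (U : (bgT3 (π i)).Cfg),
      CoRealizesRel (GD i) 1 U (RelB (π i)) (𝔬 i).blkY (𝔬 i).blk (ev i) ((𝔬 i).D U ∘ₗ (𝔬 i).G U) ∧
      CoRealizesRel (G₁ i) 1 U (RelB (π i)) (𝔬 i).blkY (𝔬 i).blk (ev i) ((𝔬 i).D U ∘ₗ (𝔬 i).G1 U))
    (hcoHR : ∀ (i : J) (U : (bgT3 (π i)).Cfg),
      CoRealizesHRel (Hk i) 0 U (2 + 1) (RelB (π i)) (𝔬 i).blk (𝔬 i).blkZ ((𝔬 i).Hm U) ∧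
      CoRealizesHRel (Hk i) 1 U (2 + 1) (RelB (π i)) (𝔬 i).blkY (𝔬 i).blkZ ((𝔬 i).D U ∘ₗ (𝔬 i).Hm U) ∧
      CoRealizesHRel (H₁k i) 0 U (2 + 1) (RelB (π i)) (𝔬 i).blk (𝔬 i).blkZ ((𝔬 i).H1m U) ∧
      CoRealizesHRel (H₁k i) 1 U (2 + 1) (RelB (π i)) (𝔬 i).blkY (𝔬 i).blkZ ((𝔬 i).D U ∘ₗ (𝔬 i).H1m U))
    (hcoG : ∀ (i : J) (U : (bgT3 (π i)).Cfg),
      CoReadsGlob (GD i) 0 U (𝔬 i).blk (𝔬 i).blk (ev i) ((𝔬 i).G U) ∧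
      CoReadsGlob (GD i) 1 U (𝔬 i).blkY (𝔬 i).blk (ev i) ((𝔬 i).D U ∘ₗ (𝔬 i).G U) ∧
      CoReadsGlob (GD i) 2 U (𝔬 i).blk (𝔬 i).blkY (evY i) ((𝔬 i).G U ∘ₗ (𝔬 i).Dstar U) ∧
      CoReadsGlob (G₁ i) 0 U (𝔬 i).blk (𝔬 i).blk (ev i) ((𝔬 i).G1 U) ∧
      CoReadsGlob (G₁ i) 1 U (𝔬 i).blkY (𝔬 i).blk (ev i) ((𝔬 i).D U ∘ₗ (𝔬 i).G1 U) ∧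
      CoReadsGlob (G₁ i) 2 U (𝔬 i).blk (𝔬 i).blkY (evY i) ((𝔬 i).G1 U ∘ₗ (𝔬 i).Dstar U))
    (hl2N : ∀ (i : J) (U : (bgT3 (π i)).Cfg),
      (L2ReadsNbr (R := (1 : ℝ)) (H := H₀ i) (GD i) 0 U (RelB (π i)) r Cev (𝔬 i).blk (𝔬 i).blk (ev i) ((𝔬 i).G U) ∧
        L2ReadsNbr (R := (1 : ℝ)) (H := H₀ i) (GD i) 1 U (RelB (π i)) r Cev (𝔬 i).blkY (𝔬 i).blk (ev i) ((𝔬 i).D U ∘ₗ (𝔬 i).G U) ∧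
        L2ReadsNbr (R := (1 : ℝ)) (H := H₀ i) (GD i) 2 U (RelB (π i)) r Cev (𝔬 i).blk (𝔬 i).blkY (evY i) ((𝔬 i).G U ∘ₗ (𝔬 i).Dstar U) ∧
        L2ReadsNbr (R := (1 : ℝ)) (H := H₀ i) (GD i) 3 U (RelB (π i)) r Cev ((𝔬 i).blk ∘ Prod.fst) (𝔬 i).blk (ev i)
          (familyOp (fun q : P × P => Dd i U q.1 ∘ₗ ((𝔬 i).G U ∘ₗ Dds i U q.2))) ∧
        L2ReadsNbr (R := (1 : ℝ)) (H := H₀ i) (GD i) 4 U (RelB (π i)) r Cev ((𝔬 i).blk ∘ Prod.fst) (𝔬 i).blk (ev i)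
          (familyOp (fun q : P × P => (Dd i U q.1 ∘ₗ Dd i U q.2) ∘ₗ (𝔬 i).G U)) ∧
        L2ReadsNbr (R := (1 : ℝ)) (H := H₀ i) (GD i) 5 U (RelB (π i)) r Cev ((𝔬 i).blk ∘ Prod.fst) (𝔬 i).blk (ev i)
          (familyOp (fun q : P × P => (𝔬 i).G U ∘ₗ (Dds i U q.1 ∘ₗ Dds i U q.2)))) ∧
      (L2ReadsNbr (R := (1 : ℝ)) (H := H₀ i) (G₁ i) 0 U (RelB (π i)) r Cev (𝔬 i).blk (𝔬 i).blk (ev i) ((𝔬 i).G1 U) ∧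
        L2ReadsNbr (R := (1 : ℝ)) (H := H₀ i) (G₁ i) 1 U (RelB (π i)) r Cev (𝔬 i).blkY (𝔬 i).blk (ev i) ((𝔬 i).D U ∘ₗ (𝔬 i).G1 U) ∧
        L2ReadsNbr (R := (1 : ℝ)) (H := H₀ i) (G₁ i) 2 U (RelB (π i)) r Cev (𝔬 i).blk (𝔬 i).blkY (evY i) ((𝔬 i).G1 U ∘ₗ (𝔬 i).Dstar U) ∧
        L2ReadsNbr (R := (1 : ℝ)) (H := H₀ i) (G₁ i) 3 U (RelB (π i)) r Cev ((𝔬 i).blk ∘ Prod.fst) (𝔬 i).blk (ev i)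
          (familyOp (fun q : P × P => Dd i U q.1 ∘ₗ ((𝔬 i).G1 U ∘ₗ Dds i U q.2))) ∧
        L2ReadsNbr (R := (1 : ℝ)) (H := H₀ i) (G₁ i) 4 U (RelB (π i)) r Cev ((𝔬 i).blk ∘ Prod.fst) (𝔬 i).blk (ev i)
          (familyOp (fun q : P × P => (Dd i U q.1 ∘ₗ Dd i U q.2) ∘ₗ (𝔬 i).G1 U)) ∧
        L2ReadsNbr (R := (1 : ℝ)) (H := H₀ i) (G₁ i) 5 U (RelB (π i)) r Cev ((𝔬 i).blk ∘ Prod.fst) (𝔬 i).blk (ev i)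
          (familyOp (fun q : P × P => (𝔬 i).G1 U ∘ₗ (Dds i U q.1 ∘ₗ Dds i U q.2)))))
    (hH1N : ∀ (i : J) (U : (bgT3 (π i)).Cfg),
      H1ReadsNbr (GD i) U (𝔭 i) (RelB (π i)) r (𝔬 i).blk (𝔬 i).blkY (ev i) (evY i) ((𝔬 i).D U ∘ₗ (𝔬 i).G U)
        ((𝔬 i).G U ∘ₗ (𝔬 i).Dstar U) ∧
      H1ReadsNbr (G₁ i) U (𝔭 i) (RelB (π i)) r (𝔬 i).blk (𝔬 i).blkY (ev i) (evY i) ((𝔬 i).D U ∘ₗ (𝔬 i).G1 U)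
        ((𝔬 i).G1 U ∘ₗ (𝔬 i).Dstar U))
    (hIF : ∀ (i : J) (U : (bgT3 (π i)).Cfg),
      InputReadsFam (GD i) U (bHX i) r ((𝔬 i).blk ∘ Prod.fst) ((𝔭 i).blkPX ∘ Prod.fst) (fun β => sliceProbe ((𝔭 i).ΦX U β)) (ev i)
        (familyOp (fun q : P × P => Dd i U q.1 ∘ₗ ((𝔬 i).G U ∘ₗ Dds i U q.2))) ∧
      InputReadsFam (G₁ i) U (bHX i) r ((𝔬 i).blk ∘ Prod.fst) ((𝔭 i).blkPX ∘ Prod.fst) (fun β => sliceProbe ((𝔭 i).ΦX U β)) (ev i)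
        (familyOp (fun q : P × P => Dd i U q.1 ∘ₗ ((𝔬 i).G1 U ∘ₗ Dds i U q.2))))
    (hHCN : ∀ (i : J) (U : (bgT3 (π i)).Cfg),
      CoReadsHHolderNbr (Hk i) U (2 + 1) (𝔭 i) r (𝔬 i).blkZ ((𝔬 i).D U ∘ₗ (𝔬 i).Hm U) ∧
      CoReadsHHolderNbr (H₁k i) U (2 + 1) (𝔭 i) r (𝔬 i).blkZ ((𝔬 i).D U ∘ₗ (𝔬 i).H1m U))
    (hsym : ∀ i : J, M₁ ≤ (geo9K (π i)).M → ∀ α₀ : ℝ, 0 < α₀ → (geo9K (π i)).M * α₀ ≤ a₁ →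
      ∀ U : (bgT3 (π i)).Cfg, (bgT3 (π i)).Reg335 c35 α₀ U → (bgT3 (π i)).Reg336 c35 α₀ U →
        (IsTransposePair ((𝔬 i).G U) ((𝔬 i).G U) ∧ IsTransposePair ((𝔬 i).G1 U) ((𝔬 i).G1 U)) ∧
        (IsTransposePair ((𝔬 i).D U ∘ₗ (𝔬 i).G U) ((𝔬 i).G U ∘ₗ (𝔬 i).Dstar U) ∧
          IsTransposePair ((𝔬 i).D U ∘ₗ (𝔬 i).G1 U) ((𝔬 i).G1 U ∘ₗ (𝔬 i).Dstar U)))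
    (hmodel : ∀ i : J, M₁ ≤ (geo9K (π i)).M → ∀ α₀ : ℝ, 0 < α₀ → (geo9K (π i)).M * α₀ ≤ a₁ →
      ∀ U : (bgT3 (π i)).Cfg, (bgT3 (π i)).Reg335 c35 α₀ U → (bgT3 (π i)).Reg336 c35 α₀ U →
        Thm33G0 (𝔬 i) 1 (H₀ i) B₀ δ₀ U ∧
        Step (𝔬 i) 1 (H₀ i) (geoOK_geo9K (π i)).lenle 1 (θ₁ * ((geo9K (π i)).M * α₀)) δK U ∧
        Step (𝔬 i) 1 (H₀ i) (geoOK_geo9K (π i)).lenle 2 (θ₁ * ((geo9K (π i)).M * α₀)) δK U ∧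
        FormSmall (𝔬 i) (r₁ * ((geo9K (π i)).M * α₀)) U ∧ Identities (𝔬 i) U)
    (hleft : ∀ i : J, M₁ ≤ (geo9K (π i)).M → ∀ α₀ : ℝ, 0 < α₀ → (geo9K (π i)).M * α₀ ≤ a₁ →
      ∀ U : (bgT3 (π i)).Cfg, (bgT3 (π i)).Reg335 c35 α₀ U → (bgT3 (π i)).Reg336 c35 α₀ U →
        LeftStep (𝔬 i) 1 (H₀ i) (geoOK_geo9K (π i)).lenle B₀ δ₀ (θD * ((geo9K (π i)).M * α₀)) δK U)
    (bZ : ∀ i : J, BlockNorm (toB6 (geo9K (π i)) 1 (H₀ i)) (Z i → ℝ)) (hκZ : ∀ i : J, (bZ i).κ = 1)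
    (hlettersH : ∀ i : J, M₁ ≤ (geo9K (π i)).M → ∀ α₀ : ℝ, 0 < α₀ → (geo9K (π i)).M * α₀ ≤ a₁ →
      ∀ U : (bgT3 (π i)).Cfg, (bgT3 (π i)).Reg335 c35 α₀ U → (bgT3 (π i)).Reg336 c35 α₀ U →
        LettersHZ (𝔬 i) 1 (H₀ i) (geoOK_geo9K (π i)) (bZ i) B₃ δ₃ U)
    (hG0C : ∀ i : J, M₁ ≤ (geo9K (π i)).M → ∀ α₀ : ℝ, 0 < α₀ → (geo9K (π i)).M * α₀ ≤ a₁ →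
      ∀ U : (bgT3 (π i)).Cfg, (bgT3 (π i)).Reg335 c35 α₀ U → (bgT3 (π i)).Reg336 c35 α₀ U →
        Thm33G0Dir (𝔬 i) (𝔭 i) (Dd i) (Dds i) 1 (H₀ i) (bHX i) B₀ Bh Bi Bi2 δ₀ U ∧
          Thm33G0L2M (𝔬 i) (Dd i) (Dds i) 1 (H₀ i) B₂ δ₀ U)
    (hstepC : ∀ i : J, M₁ ≤ (geo9K (π i)).M → ∀ α₀ : ℝ, 0 < α₀ → (geo9K (π i)).M * α₀ ≤ a₁ →
      ∀ U : (bgT3 (π i)).Cfg, (bgT3 (π i)).Reg335 c35 α₀ U → (bgT3 (π i)).Reg336 c35 α₀ U →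
        StepDirB (𝔬 i) (𝔭 i) (Dd i) (Dds i) 1 (H₀ i) (bHX i) (geoOK_geo9K (π i)).lenle (θD * ((geo9K (π i)).M * α₀))
          (fun β => θH β * ((geo9K (π i)).M * α₀)) (fun ε => θI ε * ((geo9K (π i)).M * α₀)) δK U ∧
        StepL2 (𝔬 i) 1 (H₀ i) (θ₂ * ((geo9K (π i)).M * α₀)) δK U)
    (hLHH : ∀ i : J, M₁ ≤ (geo9K (π i)).M → ∀ α₀ : ℝ, 0 < α₀ → (geo9K (π i)).M * α₀ ≤ a₁ →
      ∀ U : (bgT3 (π i)).Cfg, (bgT3 (π i)).Reg335 c35 α₀ U → (bgT3 (π i)).Reg336 c35 α₀ U →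
        LettersHHZ (𝔬 i) (𝔭 i) 1 (H₀ i) (geoOK_geo9K (π i)).lenle (bZ i) Bq δ₃ U)
    (HasRWExp : ∀ i : J, B9.KernelFamily (geo9K (π i)) (bgT3 (π i)) → (bgT3 (π i)).Cfg → ℝ → Prop)
    (HasRWExpH : ∀ i : J, B9.HKernel (geo9K (π i)) (bgT3 (π i)) → (bgT3 (π i)).Cfg → ℝ → Prop)
    (PosDefK : ∀ i : J, B9.KernelFamily (geo9K (π i)) (bgT3 (π i)) → (bgT3 (π i)).Cfg → Prop)
    (hpinE : ∀ i : J, HasRWExp i = HasRWExpOfOps (𝔬 i)) (hpinH : ∀ i : J, HasRWExpH i = HasRWExpHOfOps (𝔬 i))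
    (hpinK : ∀ i : J, PosDefK i = PosDefKOfOps (𝔬 i)) :
    B9.Thm312Printed (2 + 1) c35 (fun i : J => geo9K (π i)) (fun i : J => bgT3 (π i)) GD G₁ Hk H₁k HasRWExp HasRWExpH PosDefK := by
  classical
  have hE : HasRWExp = fun i => HasRWExpOfOps (𝔬 i) := funext hpinE
  have hH : HasRWExpH = fun i => HasRWExpHOfOps (𝔬 i) := funext hpinH
  have hK : PosDefK = fun i => PosDefKOfOps (𝔬 i) := funext hpinK
  rw [hE, hH, hK]
  obtain ⟨Mnbr, mN, hnbrF⟩ := hnbr_geo9K_floor_fam π r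
  set Mstar : ℝ := max Mnbr (r + 1) with hMstar
  have hrM : r < Mstar := lt_of_lt_of_le (lt_add_one r) (le_max_right _ _)
  let Sub : Type := {i : J // Mstar ≤ (geo9K (π i)).M}
  have hnbrSub : ∀ (j : Sub) (y : (geo9K (π j.1)).Site), (nbr (geo9K (π j.1)) r y).card ≤ mN :=
    fun j y => hnbrF ⟨j.1, (le_max_left _ _).trans j.2⟩ y
  obtain ⟨ML, c, hrow⟩ := rowSum261_geo9K (d := 2) (ℓ := ℓ) (hd := hd3) (hL := hL) (b₀ := b₀) (b₁ := b₁) σ hσ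
  have hα1 : α < 1 := by linarith
  have hL21sub : ∀ δ : ℝ, 0 < δ → ∃ ML' c' : ℝ, Lemma21AboveG (fun j : Sub => geo9K (π j.1)) (fun _ => (1 : ℝ)) (fun j => H₀ j.1) δ α ML' c' := by
    intro δ hδ
    obtain ⟨ML', c', h⟩ := lemma21AboveG_geo9K_fam π H₀ hα0 hα1 δ hδ
    exact ⟨ML', c', fun j hM => h j.1 hM⟩
  have hL1c : 1 ≤ (((ℓ + 1 : ℕ) : ℝ)) := by exact_mod_cast Nat.succ_le_succ (Nat.zero_le ℓ)
  refine thm312Printed_of_floor (geo := fun i : J => geo9K (π i)) (bg := fun i : J => bgT3 (π i)) Mstar (2 + 1) ?_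
  exact thm312Printed_completePairMBZ (geo := fun j : Sub => geo9K (π j.1)) (bg := fun j : Sub => bgT3 (π j.1))
      (fun j => 𝔬 j.1) (fun _ => 1) (fun j => H₀ j.1) (fun j => 𝔭 j.1) (fun j => bHX j.1) (fun j => Dd j.1) (fun j => Dds j.1)
      (fun j => GD j.1) (fun j => G₁ j.1) (fun j => Hk j.1) (fun j => H₁k j.1) (fun j => ev j.1) (fun j => evY j.1) (fun j => RelB (π j.1)) (2 * (2 + 1)) mN
      r Cev (((ℓ + 1 : ℕ) : ℝ)) θ₁ θD θ₂ r₁ B₀ B₂ δ₀ δK σ (max c 0) ρ ρf a₁ M₁ ML B₃ δ₃ α (((ℓ + 1 : ℕ) : ℝ)) Bh Bi Bq θH θI Bi2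
      hθ₁ hθD hθH hθI hθ₂ hr₁ hB₀ hB₂ hB₃ hσ.le hρ hρS hρδ hρ₃ (le_max_right _ _) ha₁ hM₁ hα hα0.le hρf hρf1 hρf2 hBh hBi hBi2 hBq hCev hL1c
      (fun j => geoOK_geo9K (π j.1)) (fun j => modelSignsOn_geo9K (π j.1)) (fun j => geo9K_one_le_L (π j.1)) (fun j => geo9K_L_le (π j.1)) hL1c (fun j => geo9K_eta_pos (π j.1))
      (fun j hM y => (hrow (π j.1) hM y).trans (le_max_left _ _)) hL21sub hnbrSub
      (fun j a a' h => hCL_geo9K_floor_fam π hrM j a a' h)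
      (fun j n B' δ' => ⟨fun a a' b h => maj342_relB_left (π j.1) n B' δ' a a' b h, fun a b b' h => maj342_relB_right (π j.1) n B' δ' a b b' h⟩)
      (fun j y' => card_filter_relB_le (π j.1) y') (fun j a a' b h => dist_eq_of_relB (π j.1) h (relB_refl (π j.1) b)) (fun j a a' h => len_eq_of_relB (π j.1) h)
      (fun j U => hcoR j.1 U) (fun j U => hco1R j.1 U) (fun j U => hcoHR j.1 U) (fun j U => hcoG j.1 U) (fun j U => hl2N j.1 U) (fun j U => hH1N j.1 U)
      (fun j U => hIF j.1 U) (fun j U => hHCN j.1 U)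
      (fun j hM α₀ hα₀ hMa U hU hU' => hsym j.1 hM α₀ hα₀ hMa U hU hU')
      (fun j hM α₀ hα₀ hMa U hU hU' => hmodel j.1 hM α₀ hα₀ hMa U hU hU') (fun j hM α₀ hα₀ hMa U hU hU' => hleft j.1 hM α₀ hα₀ hMa U hU hU')
      (fun j => bZ j.1) (fun j => hκZ j.1)
      (fun j hM α₀ hα₀ hMa U hU hU' => hlettersH j.1 hM α₀ hα₀ hMa U hU hU') (fun j hM α₀ hα₀ hMa U hU hU' => hG0C j.1 hM α₀ hα₀ hMa U hU hU')
      (fun j hM α₀ hα₀ hMa U hU hU' => hstepC j.1 hM α₀ hα₀ hMa U hU hU') (fun j hM α₀ hα₀ hMa U hU hU' => hLHH j.1 hM α₀ hα₀ hMa U hU hU')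

end Summit.QuantumFields.YangMills.Theorems.Prop7SectET3N06LeavesRecordHFam

end
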